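import Literature.Geometry.Riemannian.ChartMeasureComparison
import Literature.Geometry.Riemannian.PerelmanEntropy
import HarnessLib

/-!
# Sharp uniform volume asymptotics of small geodesic balls: `Vol_g B(p, r) ≤ (1 + ε) |B_r|`

For a smooth Riemannian metric `g` on a closed manifold `M` modelled on `ℝᵐ` and every `ε > 0`
we prove (`exists_forall_riemVolume_ball_le_one_add_mul`) that there is `r₀ = r₀(g, ε) > 0` with

  `Vol_g {w | d_g(p, w) < r} ≤ (1 + ε) · Leb(B_{ℝᵐ}(0, r))` for all `p ∈ M` and `0 < r ≤ r₀`,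

UNIFORMLY in the centre `p`: the sharp small-scale upper volume asymptotics
`lim_{r → 0} r⁻ᵐ Vol_g B_g(p, r) = |B₁ᵐ|` (Chavel 2006, §III.3), in its one-sided uniform form.
Here `Vol_g = g.riemVolume` is the Riemannian measure, the Euclidean-normalised Hausdorff measure
`μHE[m]` of the length distance `d_g = g.edist hg` (`Volume.lean`, `CanonicalNeighbourhoods.lean`),
so that for the flat metric it IS Lebesgue measure and the constant `1 + ε` is meaningful. The
companion lower bound with a universal (non-sharp) constant is `SmallBallVolume.lean`, the coarse
upper bound `Vol B(p, r) ≤ C rᵐ` for all radii is `UpperBallVolume.lean`.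

## Proof

Fix `C > 1` with `C^{2m} ≤ 1 + ε`. Pointwise in `p` (`exists_nhds_riemVolume_setOf_edist_lt_le`,
no compactness): linearise the chart `φ = extChartAt I p` at `p` by a square root `A` of `g_p`
(`exists_norm_eq_norm_symmL` of `VolumeChartFormula.lean`); on a neighbourhood `U` of `p` the map
`A ∘ φ` is `C`-bi-Lipschitz for `d_g` (`exists_nhds_riemannianEDist_le_and_edist_le`,
Burago–Burago–Ivanov 2001, §5.1) and `μH[m] s ≤ Cᵐ μH[m](A φ s)` for `s ⊆ U`
(`exists_nhds_hausdorffMeasure_le_and_le`; Federer 1969, §2.10.11). If `B_g(p, 2δ) ⊆ U`, then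
for every centre `q` with `d_g(p, q) < δ` and every `r ≤ δ` the ball `S = B_g(q, r)` lies in `U`,
`A φ S ⊆ B(A φ q, C r)`, and hence
`Vol_g S = σ μH[m] S ≤ σ Cᵐ μH[m] B(A φ q, C r) = Cᵐ Leb B(0, C r) = C^{2m} Leb B(0, r)` (`σ` the
common normalising factor of `μHE[m]`, Haar scaling `Measure.addHaar_ball_mul_of_pos`). The
comparison neighbourhood serves all centres near `p`, which is the local uniformity; a finite
subcover of the compact manifold and the minimum of the finitely many `δ`'s conclude.

## References

* I. Chavel, *Riemannian Geometry: A Modern Introduction*, 2nd ed., CUP 2006, §III.3 (volume of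
  small metric disks, `V(p; r) = |B₁ᵐ| rᵐ (1 + O(r²))`). [Chavel2006]
* D. Burago, Yu. Burago, S. Ivanov, *A course in metric geometry*, AMS 2001, §5.1 (charts are
  locally bi-Lipschitz with constants close to `1` for the length metric).
* H. Federer, *Geometric Measure Theory*, Springer 1969, §2.10.11 (Lipschitz maps and `H^m`),
  §3.2.46. [Federer1969]
* R. H. Bamler, *Entropy and heat kernel bounds on a Ricci flow background*, arXiv:2008.07093
  (2020), §6 (almost-Euclidean volume of small balls in the volume bounds). [Bamler2020Entropy]
-/

noncomputable section

open Set Filter Function MeasureTheory Measure Module Metric Manifold Bundle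
open scoped Manifold ContDiff Topology ENNReal NNReal

namespace Literature.Geometry.Riemannian

open Lorentzian Lorentzian.PseudoRiemannianMetric

/-- For every `ε > 0` and `m` there is a constant `C > 1` with `Cᵐ · Cᵐ ≤ 1 + ε` (continuity of
`C ↦ C^{2m}` at `1`). [folklore] -/
theorem exists_one_lt_pow_mul_pow_le (m : ℕ) {ε : ℝ} (hε : 0 < ε) :
    ∃ C : ℝ≥0, 1 < C ∧ (C : ℝ) ^ m * (C : ℝ) ^ m ≤ 1 + ε := by
  have ht : Tendsto (fun x : ℝ ↦ x ^ m * x ^ m) (𝓝 1) (𝓝 (1 ^ m * 1 ^ m)) :=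
    ((continuous_pow m).mul (continuous_pow m)).tendsto 1
  rw [one_pow, mul_one] at ht
  have hev : ∀ᶠ x : ℝ in 𝓝[>] 1, x ^ m * x ^ m < 1 + ε ∧ x ∈ Ioi 1 :=
    ((ht.eventually_lt_const (by linarith)).filter_mono nhdsWithin_le_nhds).and
      eventually_mem_nhdsWithin
  obtain ⟨C, hC, hC1⟩ := hev.exists
  rw [mem_Ioi] at hC1
  lift C to ℝ≥0 using zero_le_one.trans hC1.le
  exact ⟨C, by exact_mod_cast hC1, hC.le⟩

variable {m : ℕ} {H : Type*} [TopologicalSpace H] {I : ModelWithCorners ℝ (EuclideanSpace ℝ (Fin m)) H}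

set_option backward.isDefEq.respectTransparency false in
/-- **Sharp small-ball volume upper bound, locally uniform `ℝ≥0∞` form.** For a smooth Riemannian
`g` on a (regular) manifold modelled on `ℝᵐ`, a constant `C > 1` and a point `p`, there are a
neighbourhood `V` of `p` and `δ > 0` such that for every centre `q ∈ V` and every radius
`0 < r ≤ δ`: `Vol_g {w | d_g(q, w) < r} ≤ Cᵐ · Cᵐ · Leb(B_{ℝᵐ}(0, r))`. A linearised chart at `p`
is `C`-bi-Lipschitz on a neighbourhood of `p` (Burago–Burago–Ivanov 2001, §5.1), Lipschitz maps
expand `μH[m]` by at most `Lipᵐ` (Federer 1969, §2.10.11), and `Leb B(x, C r) = Cᵐ Leb B(0, r)`;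
`lim_{r → 0} r⁻ᵐ V(q; r) = |B₁ᵐ|` locally uniformly, Chavel 2006, §III.3.
[cite: Chavel2006, §III.3] -/
theorem exists_nhds_riemVolume_setOf_edist_lt_le {M : Type*} [TopologicalSpace M]
    [ChartedSpace H M] [IsManifold I ∞ M] [T3Space M] [MeasurableSpace M] [BorelSpace M]
    (g : PseudoRiemannianMetric I ∞ (EuclideanSpace ℝ (Fin m)) (TangentSpace I : M → Type _))
    (hg : g.IsRiemannian) {C : ℝ≥0} (hC : 1 < C) (p : M) :
    ∃ V ∈ 𝓝 p, ∃ δ : ℝ, 0 < δ ∧ ∀ q ∈ V, ∀ r : ℝ, 0 < r → r ≤ δ →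
      g.riemVolume {w | g.edist hg q w < ENNReal.ofReal r} ≤
        (C : ℝ≥0∞) ^ m * (C : ℝ≥0∞) ^ m * volume (ball (0 : EuclideanSpace ℝ (Fin m)) r) := by
  letI := g.riemannianBundle hg
  haveI := g.isContinuousRiemannianBundle hg
  letI : EMetricSpace M := EMetricSpace.ofRiemannianMetric I M
  haveI : IsRiemannianManifold I M := ⟨fun _ _ ↦ rfl⟩
  set φ := extChartAt I p with hφ
  have hp : p ∈ (chartAt H p).source := mem_chart_source H p
  -- a chart linearization `A` at `p`; `A ∘ φ` is `C`-bi-Lipschitz near `p`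
  obtain ⟨A, hA⟩ := exists_norm_eq_norm_symmL (I := I) p p
  obtain ⟨U₁, hU₁, -, -, hdle⟩ :=
    exists_nhds_riemannianEDist_le_and_edist_le (I := I) p p hp hA hC
  obtain ⟨U₂, hU₂, -, hH⟩ :=
    exists_nhds_hausdorffMeasure_le_and_le (I := I) p p hp hA hC (d := (m : ℝ)) m.cast_nonneg
  -- a distance ball `B(p, c)` inside `U₁ ∩ U₂`; `δ = c / 2`
  obtain ⟨c, hc, hcU⟩ := setOf_riemannianEDist_lt_subset_nhds I (inter_mem hU₁ hU₂)
  have hc' : (0 : ℝ) < c := NNReal.coe_pos.2 hc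
  set δ : ℝ := (c : ℝ) / 2 with hδ
  have hδ0 : 0 < δ := half_pos hc'
  have hδδ : ENNReal.ofReal δ + ENNReal.ofReal δ = (c : ℝ≥0∞) := by
    rw [← ENNReal.ofReal_add hδ0.le hδ0.le, hδ, add_halves, ENNReal.ofReal_coe_nnreal]
  refine ⟨{q | g.edist hg p q < ENNReal.ofReal δ},
    PseudoRiemannianMetric.setOf_edist_lt_mem_nhds hg p (ENNReal.ofReal_pos.2 hδ0), δ, hδ0,
    fun q hq r hr hrδ ↦ ?_⟩
  rw [mem_setOf_eq] at hq
  have hrδ' : ENNReal.ofReal r ≤ ENNReal.ofReal δ := ENNReal.ofReal_le_ofReal hrδ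
  -- the centre `q` and the ball `S = B(q, r)` lie in `U₁ ∩ U₂`
  have hqU : q ∈ U₁ ∩ U₂ := by
    refine hcU ?_
    rw [mem_setOf_eq]
    calc riemannianEDist I p q = g.edist hg p q := rfl
      _ < ENNReal.ofReal δ := hq
      _ ≤ ENNReal.ofReal δ + ENNReal.ofReal δ := le_self_add
      _ = (c : ℝ≥0∞) := hδδ
  set S := {w | g.edist hg q w < ENNReal.ofReal r} with hS
  have hSU : S ⊆ U₁ ∩ U₂ := by
    refine Subset.trans (fun w hw ↦ ?_) hcU
    rw [hS, mem_setOf_eq] at hw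
    rw [mem_setOf_eq]
    calc riemannianEDist I p w = g.edist hg p w := rfl
      _ ≤ g.edist hg p q + g.edist hg q w := PseudoRiemannianMetric.edist_triangle hg p q w
      _ < ENNReal.ofReal δ + ENNReal.ofReal r := ENNReal.add_lt_add hq hw
      _ ≤ ENNReal.ofReal δ + ENNReal.ofReal δ := by gcongr
      _ = (c : ℝ≥0∞) := hδδ
  -- the linearised chart maps `S` into the Euclidean ball `B(A φ q, C r)`
  have hC0 : (0 : ℝ) < C := zero_lt_one.trans (by exact_mod_cast hC)
  have hball : A '' (φ '' S) ⊆ ball (A (φ q)) (C * r) := by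
    rintro _ ⟨_, ⟨w, hw, rfl⟩, rfl⟩
    rw [hS, mem_setOf_eq] at hw
    rw [Metric.mem_ball, dist_comm, ← edist_lt_ofReal, ENNReal.ofReal_mul hC0.le,
      ENNReal.ofReal_coe_nnreal]
    calc edist (A (φ q)) (A (φ w)) ≤ (C : ℝ≥0∞) * riemannianEDist I q w :=
          hdle q hqU.1 w (hSU hw).1
      _ = (C : ℝ≥0∞) * g.edist hg q w := rfl
      _ < (C : ℝ≥0∞) * ENNReal.ofReal r :=
          ENNReal.mul_lt_mul_right (by exact_mod_cast hC0.ne') ENNReal.coe_ne_top hw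
  -- Hausdorff measures: `μH[m] S ≤ Cᵐ μH[m] (A φ S)`
  have hHS : μH[m] S ≤ (C : ℝ≥0∞) ^ m * μH[m] (A '' (φ '' S)) := by
    have h := (hH S (hSU.trans inter_subset_right)).1
    rwa [ENNReal.rpow_natCast] at h
  -- the common normalisation `σ` of `Vol_g = μHE[m]` (on `M`) and of Lebesgue `= μHE[m]` (on `ℝᵐ`)
  set σ : ℝ≥0 := addHaarScalarFactor (volume : Measure (EuclideanSpace ℝ (Fin m)))
    (μH[m] : Measure (EuclideanSpace ℝ (Fin m))) with hσ
  have hvolM : g.riemVolume S = (σ : ℝ≥0∞) * μH[m] S := by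
    rw [PseudoRiemannianMetric.riemVolume_eq hg]
    change riemannianVolume (g.toContMDiffRiemannianMetric hg)
      (finrank ℝ (EuclideanSpace ℝ (Fin m))) S = _
    rw [finrank_euclideanSpace_fin]
    change (μHE[m] : Measure M) S = _
    rw [Measure.euclideanHausdorffMeasure_def, Measure.smul_apply, ENNReal.smul_def, smul_eq_mul]
  have hvolF : ∀ s : Set (EuclideanSpace ℝ (Fin m)), volume s = (σ : ℝ≥0∞) * μH[m] s := by
    intro s
    rw [← EuclideanSpace.euclideanHausdorffMeasure_eq_volume m,
      Measure.euclideanHausdorffMeasure_def, Measure.smul_apply, ENNReal.smul_def, smul_eq_mul]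
  have hscale : volume (ball (A (φ q)) (C * r)) =
      (C : ℝ≥0∞) ^ m * volume (ball (0 : EuclideanSpace ℝ (Fin m)) r) := by
    rw [Measure.addHaar_ball_mul_of_pos volume _ hC0 r, finrank_euclideanSpace_fin,
      ENNReal.ofReal_pow hC0.le, ENNReal.ofReal_coe_nnreal]
  calc g.riemVolume S = (σ : ℝ≥0∞) * μH[m] S := hvolM
    _ ≤ (σ : ℝ≥0∞) * ((C : ℝ≥0∞) ^ m * μH[m] (A '' (φ '' S))) := by gcongr
    _ ≤ (σ : ℝ≥0∞) * ((C : ℝ≥0∞) ^ m * μH[m] (ball (A (φ q)) (C * r))) := by gcongr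
    _ = (C : ℝ≥0∞) ^ m * volume (ball (A (φ q)) (C * r)) := by rw [hvolF]; ring
    _ = (C : ℝ≥0∞) ^ m * (C : ℝ≥0∞) ^ m * volume (ball (0 : EuclideanSpace ℝ (Fin m)) r) := by
        rw [hscale, mul_assoc]

/-! ### The registered statement -/

/-- **Sharp uniform small-ball volume asymptotics on a closed Riemannian `m`-manifold**: for a
smooth Riemannian metric `g` on a compact manifold modelled on `ℝᵐ = EuclideanSpace ℝ (Fin m)`
and every `ε > 0` there is `r₀ = r₀(g, ε) > 0` such that
`Vol_g {w | d_g(p, w) < r} ≤ (1 + ε) · Leb(B_{ℝᵐ}(0, r))` for ALL centres `p ∈ M` and all radii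
`0 < r ≤ r₀` (the one-sided uniform form of `V(p; r) = |B₁ᵐ| rᵐ (1 + O(r²))`, Chavel 2006,
§III.3: the locally uniform bound `exists_nhds_riemVolume_setOf_edist_lt_le` with `C^{2m} ≤ 1 + ε`
and a finite subcover of the compact manifold). The binders are those of the registered stub;
`[T2Space M]` and `[SecondCountableTopology M]` are not used. [cite: Chavel2006, §III.3] -/
theorem exists_forall_riemVolume_ball_le_one_add_mul {m : ℕ} {M : Type*} [TopologicalSpace M]
    [ChartedSpace (EuclideanSpace ℝ (Fin m)) M] [IsManifold 𝓘(ℝ, EuclideanSpace ℝ (Fin m)) ∞ M]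
    [T2Space M] [CompactSpace M] [SecondCountableTopology M] [MeasurableSpace M] [BorelSpace M]
    [T3Space M]
    (g : PseudoRiemannianMetric 𝓘(ℝ, EuclideanSpace ℝ (Fin m)) ∞ (EuclideanSpace ℝ (Fin m))
      (TangentSpace 𝓘(ℝ, EuclideanSpace ℝ (Fin m)) : M → Type _)) (hg : g.IsRiemannian)
    {ε : ℝ} (hε : 0 < ε) :
    ∃ r₀ : ℝ, 0 < r₀ ∧ ∀ (p : M) (r : ℝ), 0 < r → r ≤ r₀ →
      g.riemVolume.real {w | g.edist hg p w < ENNReal.ofReal r} ≤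
        (1 + ε) * (volume (Metric.ball (0 : EuclideanSpace ℝ (Fin m)) r)).toReal := by
  -- the constant `C > 1` with `Cᵐ Cᵐ ≤ 1 + ε`
  obtain ⟨C, hC1, hCε⟩ := exists_one_lt_pow_mul_pow_le m hε
  -- local data around every point, and a finite subcover
  choose V hV δ hδ hle using
    fun p : M ↦ exists_nhds_riemVolume_setOf_edist_lt_le (I := 𝓘(ℝ, EuclideanSpace ℝ (Fin m)))
      g hg hC1 p
  obtain ⟨t, ht⟩ := CompactSpace.elim_nhds_subcover V hV
  -- `r₀` is the least of the finitely many `δ`'s (and of `1`, in case `M` is empty)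
  set s : Finset ℝ := insert 1 (t.image δ) with hs_def
  have hs : s.Nonempty := ⟨1, Finset.mem_insert_self _ _⟩
  refine ⟨s.min' hs, ?_, fun p r hr hrr₀ ↦ ?_⟩
  · refine (Finset.lt_min'_iff s hs).2 fun y hy ↦ ?_
    rcases Finset.mem_insert.1 hy with rfl | hy
    · exact one_pos
    · obtain ⟨p, -, rfl⟩ := Finset.mem_image.1 hy
      exact hδ p
  · have hp : p ∈ ⋃ x ∈ t, V x := by rw [ht]; trivial
    obtain ⟨p', hp't, hpV⟩ := mem_iUnion₂.1 hp
    have hrδ : r ≤ δ p' :=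
      hrr₀.trans (Finset.min'_le s (δ p')
        (Finset.mem_insert_of_mem (Finset.mem_image_of_mem δ hp't)))
    have h := hle p' p hpV r hr hrδ
    have hfin : (C : ℝ≥0∞) ^ m * (C : ℝ≥0∞) ^ m *
        volume (ball (0 : EuclideanSpace ℝ (Fin m)) r) ≠ ⊤ :=
      ENNReal.mul_ne_top (ENNReal.mul_ne_top (ENNReal.pow_ne_top ENNReal.coe_ne_top)
        (ENNReal.pow_ne_top ENNReal.coe_ne_top)) measure_ball_lt_top.ne
    have hreal := ENNReal.toReal_mono hfin h
    rw [ENNReal.toReal_mul, ENNReal.toReal_mul, ENNReal.toReal_pow, ENNReal.coe_toReal] at hreal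
    rw [measureReal_def]
    exact hreal.trans (mul_le_mul_of_nonneg_right hCε ENNReal.toReal_nonneg)

end Literature.Geometry.Riemannian

end
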